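import Summits.CriticalPhenomena.SAWScalingLimit.Theorems.SAWDefectDecoherenceBoundaryClosureRInnerPolygonsHalfLattice
import HarnessLib

/-!
# Crux `BoundaryClosureR` (stmt-CriticalPhenomena-14004), line `polygon-parity-squeeze`,
# stub `stub_innerPolygonsOfZigzag` (7b): explicit exact thresholds and the trimmed discretisation

Landing target:
`Summits/CriticalPhenomena/SAWScalingLimit/Theorems/SAWDefectDecoherenceBoundaryClosureRZigzagDiscretisationThresholds.lean`
(`--supports stmt-CriticalPhenomena-14004`; building block of the registered stub
`stub_innerPolygonsOfZigzag`, the lattice half of the inner-polygon construction (IP)).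

The inner exact polygon family `Λ^P_δ` of the squeeze is the TRIMMED DISCRETISATION of the inner
zigzag polygon `P`: a face `v` of `Λ_δ` is kept iff its scaled centre `δ c_v` lies in `P` and `v`
passes every LOCAL EXACTNESS TEST that sees it — at a frontier point `z` of `P` far from the corners
(`dist (δ c_v) z < r/8`, flat chart `P ∩ ball z (r/2) = halfPlane k z ∩ ball`) the test is
`T k z ≤ zigzagForm k v`; at a corner `c` (`dist < 3r/2`) it is the conjunction (convex chart) or
disjunction (reflex chart) of the two tests of the corner chart `κ c = (k, k', convex?)`.  The thresholds `T = zdT …` are EXPLICIT: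
the least exact threshold `zdThr k z δ = ⌊(2√3·Re(z conj n_k)/δ - m_k)/3⌋ + 1` strictly inside the
half-plane (so that collinear chart centres give literally equal thresholds), shifted by the float
`u = |m δ - zdThr 0 (pt 1) δ| + |m₀ δ - zdThr 0 (pt 0) δ| + 2` of the two pins, except on the two pinned
gate/root segments where the test IS the pin `m δ ≤ v.1 1` (resp. `m₀ δ`).  This file defines these
data (`zdThr`, `zdT`, the Boolean test `zdPass`, the finset `zdLam`) and proves the threshold
dictionary:

* `lt_level_of_zdThr_add_le` / `zdThr_add_le_of_lt_level` — `zdThr k z δ + q ≤ zigzagForm k v` forces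
  signed level `> (√3/2) q δ` and is forced by signed level `> (√3/6 + (√3/2) q) δ` (all `q : ℤ`);
* `zdThr_mono`, `zdThr_congr` — monotone in the level of the base point, equal on a line;
* `abs_zdT_sub_zdThr_le`, `zdT_le_of_lt_level`, `not_zdT_le_of_level_le` — the tests differ from the
  least thresholds by at most the float `u`, whence the two MARGIN rules;
* `zdPass_iff`, `mem_zdLam_iff`, `zdLam_subset`, `mem_carrier_of_mem_zdLam`.

Sources: H. Duminil-Copin, S. Smirnov, Ann. of Math. 175 (2012) §2 (domains of the hexagonal lattice);
the line card `Cruxes/BoundaryClosureR/Lines/polygon-parity-squeeze.md`.  The definitions are plain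
data (integers, a Boolean, a finset); no proposition is defined and no named fact is introduced.
-/

noncomputable section

open scoped ComplexConjugate Classical
open Set Metric
open Literature.Probability.LatticeModels

namespace Summit.CriticalPhenomena.SAWScalingLimit.Theorems.PolygonParitySqueeze.ZigzagDiscretisation

/-! ### 1. The explicit least exact threshold -/

/-- **The least exact threshold of form `k` strictly inside `halfPlane k z` at mesh `δ`**:
`⌊(2√3·Re(z·conj n_k)/δ - m_k)/3⌋ + 1`, `m_k = (3(-1)^k - 1)/2`. [folklore] -/
def zdThr (k : Fin 6) (z : ℂ) (δ : ℝ) : ℤ :=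
  ⌊(2 * Real.sqrt 3 * (z * conj (innerNormal k)).re / δ - (3 * (-1 : ℝ) ^ (k : ℕ) - 1) / 2) / 3⌋ + 1

/-- **Faces above the shifted threshold are deep**: `zdThr k z δ + q ≤ zigzagForm k v` forces the signed
level of `δ c_v` to exceed `(√3/2)·q·δ`. [folklore] -/
theorem lt_level_of_zdThr_add_le (k : Fin 6) (z : ℂ) {δ : ℝ} (hδ : 0 < δ) (q : ℤ) (v : HexVertex)
    (h : zdThr k z δ + q ≤ zigzagForm k v) :
    δ * (Real.sqrt 3 / 2 * q) < (((δ : ℂ) * hexCenter v - z) * conj (innerNormal k)).re := by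
  set m : ℝ := (3 * (-1 : ℝ) ^ (k : ℕ) - 1) / 2 with hm
  set L : ℝ := (z * conj (innerNormal k)).re with hL
  set A : ℝ := 2 * Real.sqrt 3 * L / δ with hA
  set N : ℤ := ⌊(A - m) / 3⌋ with hN
  have h3 : Real.sqrt 3 * Real.sqrt 3 = 3 := Real.mul_self_sqrt (by norm_num)
  have h3p : 0 < Real.sqrt 3 := Real.sqrt_pos.2 (by norm_num)
  have hn : zdThr k z δ = N + 1 := rfl
  have hfl1 : (A - m) / 3 < (N : ℝ) + 1 := Int.lt_floor_add_one _
  have hf' : ((N + 1 + q : ℤ) : ℝ) ≤ zigzagForm k v := by exact_mod_cast (hn ▸ h)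
  push_cast at hf'
  have hge := level_ge k v
  rw [← hm] at hge
  rw [signedLevel_smul_sub, ← hL]
  -- `L < (√3/6)(3(N+1)+m) δ`
  have hA1 : 2 * Real.sqrt 3 * L < (3 * ((N : ℝ) + 1) + m) * δ := by
    rw [← div_lt_iff₀ hδ]; linarith
  have s2 : L < Real.sqrt 3 / 6 * (3 * ((N : ℝ) + 1) + m) * δ := by
    have := mul_lt_mul_of_pos_left hA1 (show (0 : ℝ) < Real.sqrt 3 / 6 by positivity)
    have e : Real.sqrt 3 / 6 * (2 * Real.sqrt 3 * L) = L := by linear_combination (L / 3) * h3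
    linarith
  -- `(√3/6)(3(N+1+q)+m) ≤ level of c_v`
  have s1 : Real.sqrt 3 / 6 * (3 * ((N : ℝ) + 1 + q) + m) ≤ (hexCenter v * conj (innerNormal k)).re := by
    refine le_trans ?_ hge
    have : 3 * ((N : ℝ) + 1 + q) + m ≤ 3 * (zigzagForm k v : ℝ) + m := by linarith
    exact mul_le_mul_of_nonneg_left this (by positivity)
  have s3 := mul_le_mul_of_nonneg_left s1 hδ.le
  linarith

/-- **Deep faces are above the shifted threshold**: signed level `> (√3/6 + (√3/2) q)·δ` forces
`zdThr k z δ + q ≤ zigzagForm k v`. [folklore] -/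
theorem zdThr_add_le_of_lt_level (k : Fin 6) (z : ℂ) {δ : ℝ} (hδ : 0 < δ) (q : ℤ) (v : HexVertex)
    (h : δ * (Real.sqrt 3 / 6 + Real.sqrt 3 / 2 * q) < (((δ : ℂ) * hexCenter v - z) * conj (innerNormal k)).re) :
    zdThr k z δ + q ≤ zigzagForm k v := by
  set m : ℝ := (3 * (-1 : ℝ) ^ (k : ℕ) - 1) / 2 with hm
  set L : ℝ := (z * conj (innerNormal k)).re with hL
  set A : ℝ := 2 * Real.sqrt 3 * L / δ with hA
  set N : ℤ := ⌊(A - m) / 3⌋ with hN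
  have h3 : Real.sqrt 3 * Real.sqrt 3 = 3 := Real.mul_self_sqrt (by norm_num)
  have h3p : 0 < Real.sqrt 3 := Real.sqrt_pos.2 (by norm_num)
  have hn : zdThr k z δ = N + 1 := rfl
  have hfl2 : (N : ℝ) ≤ (A - m) / 3 := Int.floor_le _
  by_contra hf
  have hf1 : zigzagForm k v ≤ N + q := by rw [hn] at hf; omega
  have hf' : (zigzagForm k v : ℝ) ≤ (N : ℝ) + q := by exact_mod_cast hf1
  have hle := level_le k v
  have hm1 : (3 * (-1 : ℝ) ^ (k : ℕ) + 1) / 2 = m + 1 := by rw [hm]; ring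
  rw [hm1] at hle
  rw [signedLevel_smul_sub, ← hL] at h
  -- `(√3/6)(3N + m) δ ≤ L`
  have hA2 : (3 * (N : ℝ) + m) * δ ≤ 2 * Real.sqrt 3 * L := by
    rw [← le_div_iff₀ hδ]; linarith
  have s2 : Real.sqrt 3 / 6 * (3 * (N : ℝ) + m) * δ ≤ L := by
    have := mul_le_mul_of_nonneg_left hA2 (show (0 : ℝ) ≤ Real.sqrt 3 / 6 by positivity)
    have e : Real.sqrt 3 / 6 * (2 * Real.sqrt 3 * L) = L := by linear_combination (L / 3) * h3
    linarith
  -- `level of c_v ≤ (√3/6)(3(N+q) + m + 1)`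
  have s1 : (hexCenter v * conj (innerNormal k)).re ≤ Real.sqrt 3 / 6 * (3 * ((N : ℝ) + q) + m + 1) := by
    refine hle.trans ?_
    have : 3 * (zigzagForm k v : ℝ) + (m + 1) ≤ 3 * ((N : ℝ) + q) + m + 1 := by linarith
    exact mul_le_mul_of_nonneg_left this (by positivity)
  have s3 := mul_le_mul_of_nonneg_left s1 hδ.le
  linarith

/-- Faces above the least threshold are strictly inside the half-plane (`q = 0`). [folklore] -/
theorem mem_halfPlane_of_zdThr_le (k : Fin 6) (z : ℂ) {δ : ℝ} (hδ : 0 < δ) (v : HexVertex)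
    (h : zdThr k z δ ≤ zigzagForm k v) : (δ : ℂ) * hexCenter v ∈ halfPlane k z := by
  have := lt_level_of_zdThr_add_le k z hδ 0 v (by simpa using h)
  rw [mem_halfPlane_iff_level]
  simpa using this

/-- Faces at signed level `> δ√3/6` are above the least threshold (`q = 0`). [folklore] -/
theorem zdThr_le_of_lt_level (k : Fin 6) (z : ℂ) {δ : ℝ} (hδ : 0 < δ) (v : HexVertex)
    (h : δ * (Real.sqrt 3 / 6) < (((δ : ℂ) * hexCenter v - z) * conj (innerNormal k)).re) :
    zdThr k z δ ≤ zigzagForm k v := by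
  have := zdThr_add_le_of_lt_level k z hδ 0 v (by simpa using h)
  simpa using this

/-- **The least threshold is monotone in the level of the base point.** [folklore] -/
theorem zdThr_mono (k : Fin 6) {z z' : ℂ} {δ : ℝ} (hδ : 0 < δ)
    (h : (z * conj (innerNormal k)).re ≤ (z' * conj (innerNormal k)).re) : zdThr k z δ ≤ zdThr k z' δ := by
  unfold zdThr
  gcongr

/-- **Collinear base points give the same threshold.** [folklore] -/
theorem zdThr_congr (k : Fin 6) {z z' : ℂ} (δ : ℝ)
    (h : (z * conj (innerNormal k)).re = (z' * conj (innerNormal k)).re) : zdThr k z δ = zdThr k z' δ := by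
  unfold zdThr; rw [h]

/-- Base points on a line: `Re((z' - z) conj n_k) = 0` iff equal levels. [folklore] -/
theorem level_eq_of_sub_level_eq_zero (k : Fin 6) {z z' : ℂ} (h : ((z' - z) * conj (innerNormal k)).re = 0) :
    (z * conj (innerNormal k)).re = (z' * conj (innerNormal k)).re := by
  rw [sub_mul, Complex.sub_re] at h; linarith

/-- The level against `n_0 = i` is the height. [folklore] -/
theorem level_zero_eq_im (z : ℂ) : (z * conj (innerNormal 0)).re = z.im := by
  simp [innerNormal_eq]

/-- **An up face strictly above the horizontal line through `x₁` is at or above the least threshold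
row of form `0`** (how the pins `m δ`, `m₀ δ` are compared with `zdThr 0 (pt i) δ`). [folklore] -/
theorem zdThr_zero_le_row (x₁ : ℂ) {δ : ℝ} (hδ : 0 < δ) (x : Site 2)
    (h : x₁.im < ((δ : ℂ) * hexCenter ((x, 0) : HexVertex)).im) : zdThr 0 x₁ δ ≤ x 1 := by
  have h3 : Real.sqrt 3 * Real.sqrt 3 = 3 := Real.mul_self_sqrt (by norm_num)
  have h3p : 0 < Real.sqrt 3 := Real.sqrt_pos.2 (by norm_num)
  have him : ((δ : ℂ) * hexCenter ((x, 0) : HexVertex)).im = δ * (((x 1 : ℤ) : ℝ) + 1 / 3) * (Real.sqrt 3 / 2) := by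
    rw [Complex.im_ofReal_mul, Literature.Probability.Percolation.hexCenter_im]
    simp; ring
  rw [him] at h
  unfold zdThr
  rw [level_zero_eq_im]
  simp only [Fin.val_zero, pow_zero]
  have key : (2 * Real.sqrt 3 * x₁.im / δ - (3 * 1 - 1) / 2) / 3 < (x 1 : ℝ) := by
    rw [div_lt_iff₀ (by norm_num : (0:ℝ) < 3), sub_lt_iff_lt_add, div_lt_iff₀ hδ]
    have h1 := mul_lt_mul_of_pos_left h (show (0:ℝ) < 2 * Real.sqrt 3 by positivity)
    have e : 2 * Real.sqrt 3 * (δ * (((x 1 : ℤ) : ℝ) + 1 / 3) * (Real.sqrt 3 / 2)) = ((x 1 : ℝ) * 3 + 1) * δ := by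
      linear_combination (δ * (((x 1 : ℤ) : ℝ) + 1 / 3)) * h3
    linarith
  have := Int.floor_le ((2 * Real.sqrt 3 * x₁.im / δ - (3 * 1 - 1) / 2) / 3)
  have hlt : (⌊(2 * Real.sqrt 3 * x₁.im / δ - (3 * 1 - 1) / 2) / 3⌋ : ℝ) < (x 1 : ℝ) := this.trans_lt key
  have : ⌊(2 * Real.sqrt 3 * x₁.im / δ - (3 * 1 - 1) / 2) / 3⌋ < x 1 := by exact_mod_cast hlt
  omega

/-! ### 2. The tests of the trimmed discretisation -/

/-- **The test thresholds.**  Pin data: gate point `x₁`, radius `ρ`, gate row `m`; root point `x₀`,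
radius `r₁`, root row `m₀` (at the current mesh `δ`).  On the pinned gate segment (form `0`, the
horizontal line through `x₁`, within `ρ` of `x₁`) the threshold IS the pin `m`; on the root segment it
is `m₀`; everywhere else it is the least exact threshold shifted by the float
`|m - zdThr 0 x₁ δ| + |m₀ - zdThr 0 x₀ δ| + 2`. [folklore] -/
def zdT (x₁ x₀ : ℂ) (ρ r₁ : ℝ) (m m₀ : ℤ) (δ : ℝ) (k : Fin 6) (z : ℂ) : ℤ :=
  if k = 0 ∧ z.im = x₁.im ∧ dist z x₁ < ρ then m
  else if k = 0 ∧ z.im = x₀.im ∧ dist z x₀ < r₁ then m₀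
  else zdThr k z δ + (|m - zdThr 0 x₁ δ| + |m₀ - zdThr 0 x₀ δ| + 2)

/-- **The Boolean local exactness test** of a face `v` at mesh `δ` against the set `S` (the carrier
of the inner polygon), the corner set `Cor` with corner charts `κ c = (k, k', convex?)`, the structure
radius `r` and thresholds `T`: the scaled centre lies in `S`, every flat chart at an `r`-far frontier
point within `r/8` is passed, and the chart of every corner within `3r/2` is passed (conjunction of
the two form tests at a convex corner, disjunction at a reflex one). [folklore] -/
def zdPass (S : Set ℂ) (Cor : Finset ℂ) (κ : ℂ → Fin 6 × Fin 6 × Bool) (r : ℝ) (T : Fin 6 → ℂ → ℤ) (δ : ℝ)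
    (v : HexVertex) : Bool :=
  decide ((δ : ℂ) * hexCenter v ∈ S ∧
    (∀ z ∈ frontier S, (∀ c ∈ Cor, r ≤ dist z c) → dist ((δ : ℂ) * hexCenter v) z < r / 8 →
      ∀ k : Fin 6, S ∩ ball z (r / 2) = halfPlane k z ∩ ball z (r / 2) → T k z ≤ zigzagForm k v) ∧
    (∀ c ∈ Cor, dist ((δ : ℂ) * hexCenter v) c < 3 * r / 2 →
      ((κ c).2.2 = true → T (κ c).1 c ≤ zigzagForm (κ c).1 v ∧ T (κ c).2.1 c ≤ zigzagForm (κ c).2.1 v) ∧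
      ((κ c).2.2 = false → T (κ c).1 c ≤ zigzagForm (κ c).1 v ∨ T (κ c).2.1 c ≤ zigzagForm (κ c).2.1 v)))

/-- **The trimmed discretisation** `Λ^P_δ`: the faces of `Λ δ` passing the test with the thresholds
`zdT x₁ x₀ ρ r₁ (m δ) (m₀ δ) δ`. [folklore] -/
def zdLam (S : Set ℂ) (Cor : Finset ℂ) (κ : ℂ → Fin 6 × Fin 6 × Bool) (r : ℝ) (x₁ x₀ : ℂ) (ρ r₁ : ℝ)
    (Λ : ℝ → Finset HexVertex) (m m₀ : ℝ → ℤ) (δ : ℝ) : Finset HexVertex :=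
  (Λ δ).filter fun v => zdPass S Cor κ r (zdT x₁ x₀ ρ r₁ (m δ) (m₀ δ) δ) δ v = true

/-- Unfolding the Boolean test. [folklore] -/
theorem zdPass_iff (S : Set ℂ) (Cor : Finset ℂ) (κ : ℂ → Fin 6 × Fin 6 × Bool) (r : ℝ) (T : Fin 6 → ℂ → ℤ)
    (δ : ℝ) (v : HexVertex) :
    zdPass S Cor κ r T δ v = true ↔ ((δ : ℂ) * hexCenter v ∈ S ∧
    (∀ z ∈ frontier S, (∀ c ∈ Cor, r ≤ dist z c) → dist ((δ : ℂ) * hexCenter v) z < r / 8 →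
      ∀ k : Fin 6, S ∩ ball z (r / 2) = halfPlane k z ∩ ball z (r / 2) → T k z ≤ zigzagForm k v) ∧
    (∀ c ∈ Cor, dist ((δ : ℂ) * hexCenter v) c < 3 * r / 2 →
      ((κ c).2.2 = true → T (κ c).1 c ≤ zigzagForm (κ c).1 v ∧ T (κ c).2.1 c ≤ zigzagForm (κ c).2.1 v) ∧
      ((κ c).2.2 = false → T (κ c).1 c ≤ zigzagForm (κ c).1 v ∨ T (κ c).2.1 c ≤ zigzagForm (κ c).2.1 v))) := by
  rw [zdPass, decide_eq_true_iff]

/-- Membership in the trimmed discretisation. [folklore] -/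
theorem mem_zdLam_iff (S : Set ℂ) (Cor : Finset ℂ) (κ : ℂ → Fin 6 × Fin 6 × Bool) (r : ℝ) (x₁ x₀ : ℂ) (ρ r₁ : ℝ)
    (Λ : ℝ → Finset HexVertex) (m m₀ : ℝ → ℤ) (δ : ℝ) (v : HexVertex) :
    v ∈ zdLam S Cor κ r x₁ x₀ ρ r₁ Λ m m₀ δ ↔
      v ∈ Λ δ ∧ zdPass S Cor κ r (zdT x₁ x₀ ρ r₁ (m δ) (m₀ δ) δ) δ v = true := by
  rw [zdLam, Finset.mem_filter]

/-- The trimmed discretisation is a sub-domain of `Λ δ`. [folklore] -/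
theorem zdLam_subset (S : Set ℂ) (Cor : Finset ℂ) (κ : ℂ → Fin 6 × Fin 6 × Bool) (r : ℝ) (x₁ x₀ : ℂ) (ρ r₁ : ℝ)
    (Λ : ℝ → Finset HexVertex) (m m₀ : ℝ → ℤ) (δ : ℝ) : zdLam S Cor κ r x₁ x₀ ρ r₁ Λ m m₀ δ ⊆ Λ δ :=
  Finset.filter_subset _ _

/-- Kept faces have their scaled centre in the carrier. [folklore] -/
theorem mem_carrier_of_mem_zdLam {S : Set ℂ} {Cor : Finset ℂ} {κ : ℂ → Fin 6 × Fin 6 × Bool} {r : ℝ} {x₁ x₀ : ℂ}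
    {ρ r₁ : ℝ} {Λ : ℝ → Finset HexVertex} {m m₀ : ℝ → ℤ} {δ : ℝ} {v : HexVertex}
    (h : v ∈ zdLam S Cor κ r x₁ x₀ ρ r₁ Λ m m₀ δ) : (δ : ℂ) * hexCenter v ∈ S := by
  rw [mem_zdLam_iff, zdPass_iff] at h
  exact h.2.1

/-! ### 3. The test thresholds versus the least thresholds: the two margin rules -/

section Margins

variable (x₁ x₀ : ℂ) (ρ r₁ : ℝ) (m m₀ : ℤ) {δ : ℝ}

/-- On the gate segment the threshold is the gate pin. [folklore] -/
theorem zdT_gate {z : ℂ} (δ : ℝ) (hz : z.im = x₁.im) (hd : dist z x₁ < ρ) : zdT x₁ x₀ ρ r₁ m m₀ δ 0 z = m := by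
  simp [zdT, hz, hd]

/-- On the root segment (off the gate segment) the threshold is the root pin. [folklore] -/
theorem zdT_root {z : ℂ} (δ : ℝ) (hz : z.im = x₀.im) (hd : dist z x₀ < r₁) (hsep : ρ + r₁ ≤ dist x₀ x₁) :
    zdT x₁ x₀ ρ r₁ m m₀ δ 0 z = m₀ := by
  have hng : ¬ dist z x₁ < ρ := by
    intro h
    have := dist_triangle_left x₀ x₁ z
    linarith
  simp [zdT, hz, hd, hng]

/-- Off the two pinned segments the threshold is the least threshold shifted by the float. [folklore] -/
theorem zdT_generic {k : Fin 6} {z : ℂ} (δ : ℝ) (h₁ : ¬ (k = 0 ∧ z.im = x₁.im ∧ dist z x₁ < ρ))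
    (h₀ : ¬ (k = 0 ∧ z.im = x₀.im ∧ dist z x₀ < r₁)) :
    zdT x₁ x₀ ρ r₁ m m₀ δ k z = zdThr k z δ + (|m - zdThr 0 x₁ δ| + |m₀ - zdThr 0 x₀ δ| + 2) := by
  rw [zdT, if_neg h₁, if_neg h₀]

/-- **The test thresholds differ from the least thresholds by at most the float.** [folklore] -/
theorem abs_zdT_sub_zdThr_le (k : Fin 6) (z : ℂ) (δ : ℝ) :
    |zdT x₁ x₀ ρ r₁ m m₀ δ k z - zdThr k z δ| ≤ |m - zdThr 0 x₁ δ| + |m₀ - zdThr 0 x₀ δ| + 2 := by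
  have ha := abs_nonneg (m - zdThr 0 x₁ δ)
  have hb := abs_nonneg (m₀ - zdThr 0 x₀ δ)
  unfold zdT
  split_ifs with h1 h2
  · obtain ⟨rfl, hz, -⟩ := h1
    rw [zdThr_congr 0 δ (show (z * conj (innerNormal 0)).re = (x₁ * conj (innerNormal 0)).re by
      rw [level_zero_eq_im, level_zero_eq_im, hz])]
    linarith
  · obtain ⟨rfl, hz, -⟩ := h2
    rw [zdThr_congr 0 δ (show (z * conj (innerNormal 0)).re = (x₀ * conj (innerNormal 0)).re by
      rw [level_zero_eq_im, level_zero_eq_im, hz])]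
    linarith
  · rw [add_sub_cancel_left, abs_of_nonneg (by positivity)]

/-- **MARGIN RULE (pass)**: a face at signed level `> (√3/6 + (√3/2)·u)·δ` in a chart passes its test,
`u` the float. [folklore] -/
theorem zdT_le_of_lt_level (hδ : 0 < δ) (k : Fin 6) (z : ℂ) (v : HexVertex)
    (h : δ * (Real.sqrt 3 / 6 + Real.sqrt 3 / 2 * ((|m - zdThr 0 x₁ δ| + |m₀ - zdThr 0 x₀ δ| + 2 : ℤ) : ℝ)) <
      (((δ : ℂ) * hexCenter v - z) * conj (innerNormal k)).re) :
    zdT x₁ x₀ ρ r₁ m m₀ δ k z ≤ zigzagForm k v := by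
  have h1 := zdThr_add_le_of_lt_level k z hδ _ v h
  have h2 := abs_zdT_sub_zdThr_le x₁ x₀ ρ r₁ m m₀ k z δ
  rw [abs_le] at h2
  linarith [h2.2]

/-- **MARGIN RULE (fail)**: a face at signed level `≤ -(√3/2)·u·δ` in a chart fails its test. [folklore] -/
theorem not_zdT_le_of_level_le (hδ : 0 < δ) (k : Fin 6) (z : ℂ) (v : HexVertex)
    (h : (((δ : ℂ) * hexCenter v - z) * conj (innerNormal k)).re ≤
      -(δ * (Real.sqrt 3 / 2 * ((|m - zdThr 0 x₁ δ| + |m₀ - zdThr 0 x₀ δ| + 2 : ℤ) : ℝ)))) :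
    ¬ zdT x₁ x₀ ρ r₁ m m₀ δ k z ≤ zigzagForm k v := by
  intro hle
  have h2 := abs_zdT_sub_zdThr_le x₁ x₀ ρ r₁ m m₀ k z δ
  rw [abs_le] at h2
  have h3 : zdThr k z δ + (-(|m - zdThr 0 x₁ δ| + |m₀ - zdThr 0 x₀ δ| + 2)) ≤ zigzagForm k v := by linarith [h2.1]
  have := lt_level_of_zdThr_add_le k z hδ _ v h3
  push_cast at this h
  linarith

/-- Passing a test puts the scaled centre strictly inside the half-plane, up to the float:
signed level `> -(√3/2)·u·δ`. [folklore] -/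
theorem level_gt_of_zdT_le (hδ : 0 < δ) (k : Fin 6) (z : ℂ) (v : HexVertex)
    (h : zdT x₁ x₀ ρ r₁ m m₀ δ k z ≤ zigzagForm k v) :
    -(δ * (Real.sqrt 3 / 2 * ((|m - zdThr 0 x₁ δ| + |m₀ - zdThr 0 x₀ δ| + 2 : ℤ) : ℝ))) <
      (((δ : ℂ) * hexCenter v - z) * conj (innerNormal k)).re := by
  by_contra hc
  exact not_zdT_le_of_level_le x₁ x₀ ρ r₁ m m₀ hδ k z v (not_lt.1 hc) h

/-- **Passing a GENERIC test is deep**: off the pinned segments, `T ≤ zigzagForm k v` forces signed level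
`> (√3/2)·u·δ ≥ √3·δ`. [folklore] -/
theorem level_gt_of_zdT_le_generic (hδ : 0 < δ) {k : Fin 6} {z : ℂ} (v : HexVertex)
    (h₁ : ¬ (k = 0 ∧ z.im = x₁.im ∧ dist z x₁ < ρ)) (h₀ : ¬ (k = 0 ∧ z.im = x₀.im ∧ dist z x₀ < r₁))
    (h : zdT x₁ x₀ ρ r₁ m m₀ δ k z ≤ zigzagForm k v) :
    δ * (Real.sqrt 3 / 2 * ((|m - zdThr 0 x₁ δ| + |m₀ - zdThr 0 x₀ δ| + 2 : ℤ) : ℝ)) <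
      (((δ : ℂ) * hexCenter v - z) * conj (innerNormal k)).re := by
  rw [zdT_generic x₁ x₀ ρ r₁ m m₀ δ h₁ h₀] at h
  exact lt_level_of_zdThr_add_le k z hδ _ v h

end Margins

/-- **The explicit threshold dictionary** (registered form, sub-goal of `stub_innerPolygonsOfZigzag`).
[folklore] -/
theorem zd_thresholds : ∀ (k : Fin 6) (z : ℂ) (δ : ℝ), 0 < δ → ∀ (q : ℤ) (v : HexVertex), (zdThr k z δ + q ≤ zigzagForm k v → δ * (Real.sqrt 3 / 2 * q) < (((δ : ℂ) * hexCenter v - z) * (starRingEnd ℂ) (innerNormal k)).re) ∧ (δ * (Real.sqrt 3 / 6 + Real.sqrt 3 / 2 * q) < (((δ : ℂ) * hexCenter v - z) * (starRingEnd ℂ) (innerNormal k)).re → zdThr k z δ + q ≤ zigzagForm k v) :=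
  fun k z _ hδ q v => ⟨lt_level_of_zdThr_add_le k z hδ q v, zdThr_add_le_of_lt_level k z hδ q v⟩

end Summit.CriticalPhenomena.SAWScalingLimit.Theorems.PolygonParitySqueeze.ZigzagDiscretisation

end
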